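import Mathlib
import Literature.Computability.AlgebraicComplexity.SecondFundamentalTheoremGL
import Summits.MatrixMultiplication.MatrixMultiplication.Theorems.LevelOneGL2Designs.Negative.LevelSpace
import Summits.MatrixMultiplication.MatrixMultiplication.Theorems.LieRankDesigns.Negative.RadicalBoxes

/-!
# Frame ghosts: the exact FAIL ⟺ criterion for level-`k` identity tests in `GL_m(𝔽_p)`, all `m`, `k`, `p`
(negative-side structure theorem for the crux `SubgroupIdentityDesigns`, stmt-MatrixMultiplication-14079;
cell B2b-5 `b2b-lgcu-borel`, gen 11 — report `run/shared/lean/b2b/levelgraded-cu/ORACLE-g11.md` §G11-2)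

The level-`k` test space `F_k|_G = levelSubmodule p m k` (`fourierFn c`, `c` supported on `rk M ≤ k`)
is the span of the FRAME-TRANSPORT INDICATORS `g ↦ [g B = A]`, `A, B ∈ M_{m×k}(𝔽_p)` (the `k` columns
of `B` are carried onto the `k` columns of `A`):
* `transport_mem` — `[g B = A] = p^{-mk} Σ_W ψ(-tr(A Wᵀ)) ψ(tr((B Wᵀ) g))` and `rk(B Wᵀ) ≤ k`, so every
  transport indicator is a level-`k` function (box orthogonality `sum_psi_array`);
* `sum_mul_eq_zero_of_frameGhost` — conversely a rank-`≤ k` mode factors as `M = U W` (`U : m×k`,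
  `W : k×m`; `Literature…exists_eq_mul_of_rank_le`), and `ψ(tr(U W g)) = ψ(tr(W (gU)))` depends on `g`
  only through the frame image `g U`; hence a FRAME GHOST — a weight `w` on `GL_m(𝔽_p)` all of whose
  transport sums `Σ_{g : gB = A} w(g)` vanish — annihilates every level-`k` function.
Consequences (all `m`, `k`, `p`):
* `no_idTest_of_frameGhost`, `no_design_of_frameGhost` — a frame ghost supported in `S` (resp. in the
  triple products `H₁H₂H₃`) with `w(1) ≠ 0` refutes every level-`k` identity test on `S` (resp. the
  identity-design clause of the crux for `(H₁,H₂,H₃)` at level `k`).  This subsumes the cell's earlier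
  certificate-soundness theorems (`FibreGhost`, `m = 2`, `k = 1`; `BorelGhost`; `TorusGhost`'s coset
  ghosts) in one statement for every cell `(m,k,p)`;
* `exists_frameGhost_of_no_idTest` — COMPLETENESS (finite-dimensional duality,
  `Submodule.exists_dual_map_eq_bot_of_notMem`): if NO level-`k` identity test exists on `S ∋ 1` then a
  frame ghost supported in `S` with `w(1) ≠ 0` EXISTS;
* `idTest_iff_no_frameGhost`, `design_iff_no_frameGhost` — so the identity-design clause of
  `SubgroupIdentityDesigns` at `(m,k,p)` for `(H₁,H₂,H₃)` holds IFF no frame ghost with `w(1) ≠ 0` lives on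
  `H₁H₂H₃`: the clause is decided, in either direction, by a finite certificate checked against transport
  sums only (PASS: a combination of transport indicators; FAIL: a ghost).
Sorry-free.  VALUE = structure theorem + kernel-sound two-sided certificate format for every finite cell of
the crux, NOT summit progress; the crux item stays open.
-/

set_option linter.dupNamespace false

noncomputable section

open scoped BigOperators Classical Matrix

namespace Summit.MatrixMultiplication.MatrixMultiplication.Theorems.SubgroupIdentityDesigns.Negative
namespace FrameGhost

open Summit.MatrixMultiplication.MatrixMultiplication.Theorems.LieRankDesigns.Negative
  (GLm Mat fourierFn RankSupp sum_psi_vec)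
open Summit.MatrixMultiplication.MatrixMultiplication.Theorems.LevelOneGL2Designs.Negative
  (levelSubmodule mem_levelSubmodule_iff fourierFn_mem_levelSubmodule)
open Literature.Computability.AlgebraicComplexity (exists_eq_mul_of_rank_le)

variable {p m k : ℕ} [hp : Fact p.Prime]

/-! ## Box orthogonality on `m × k` arrays and the trace pairing -/

/-- `Σ_W ψ(Σ_{i,j} X i j · W i j) = p^{mk} · [X = 0]` over all `m × k` arrays `W`. [folklore] -/
theorem sum_psi_array (X : Fin m → Fin k → ZMod p) :
    ∑ W : Fin m → Fin k → ZMod p, ZMod.stdAddChar (∑ i, ∑ j, X i j * W i j) =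
      if X = 0 then ((p : ℂ) ^ (m * k)) else 0 := by
  have hexp : ∀ W : Fin m → Fin k → ZMod p, ZMod.stdAddChar (∑ i, ∑ j, X i j * W i j) =
      ∏ i, ZMod.stdAddChar (∑ j, X i j * W i j) := fun W => stdAddChar_map_sum _ _
  simp_rw [hexp]
  rw [← Fintype.prod_sum (fun i (r : Fin k → ZMod p) => ZMod.stdAddChar (∑ j, X i j * r j))]
  simp_rw [sum_psi_vec]
  split_ifs with hX
  · subst hX
    simp [Finset.prod_const, Finset.card_univ, pow_mul']
  · obtain ⟨i, hi⟩ := Function.ne_iff.mp hX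
    exact Finset.prod_eq_zero (Finset.mem_univ i) (by rw [if_neg (by simpa using hi)])

/-- `tr(X Wᵀ) = Σ_{i,j} X i j · W i j` for `m × k` matrices. [folklore] -/
theorem trace_mul_transpose_eq (X W : Matrix (Fin m) (Fin k) (ZMod p)) :
    Matrix.trace (X * Wᵀ) = ∑ i, ∑ j, X i j * W i j := by
  simp [Matrix.trace, Matrix.mul_apply]

/-- **The transport indicator as a character sum**:
`[g B = A] = p^{-mk} Σ_W ψ(-tr(A Wᵀ)) · ψ(tr((B Wᵀ) g))`. [folklore] -/
theorem transport_eq_sum (B A : Matrix (Fin m) (Fin k) (ZMod p)) (g : GLm p m) :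
    (if (g : Mat p m) * B = A then (1 : ℂ) else 0) =
      ((p : ℂ) ^ (m * k))⁻¹ * ∑ W : Fin m → Fin k → ZMod p,
        ZMod.stdAddChar (-Matrix.trace (A * (Matrix.of W)ᵀ)) *
          ZMod.stdAddChar (Matrix.trace (B * (Matrix.of W)ᵀ * (g : Mat p m))) := by
  have key : ∀ W : Fin m → Fin k → ZMod p,
      ZMod.stdAddChar (-Matrix.trace (A * (Matrix.of W)ᵀ)) *
          ZMod.stdAddChar (Matrix.trace (B * (Matrix.of W)ᵀ * (g : Mat p m))) =
        ZMod.stdAddChar (∑ i, ∑ j, (fun i j => ((g : Mat p m) * B - A) i j) i j * W i j) := by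
    intro W
    rw [← AddChar.map_add_eq_mul, Matrix.trace_mul_comm (B * (Matrix.of W)ᵀ) (g : Mat p m),
      ← Matrix.mul_assoc, trace_mul_transpose_eq, trace_mul_transpose_eq]
    congr 1
    simp only [Matrix.sub_apply, sub_mul, Finset.sum_sub_distrib, Matrix.of_apply]
    ring
  simp_rw [key]
  rw [sum_psi_array]
  have hp0 : ((p : ℂ) ^ (m * k)) ≠ 0 := pow_ne_zero _ (Nat.cast_ne_zero.mpr hp.out.ne_zero)
  by_cases h : (g : Mat p m) * B = A
  · have h0 : (fun i j => ((g : Mat p m) * B - A) i j) = 0 := by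
      funext i j; simp [h]
    rw [if_pos h, if_pos h0, inv_mul_cancel₀ hp0]
  · have h0 : (fun i j => ((g : Mat p m) * B - A) i j) ≠ 0 := by
      intro h0
      apply h
      rw [← sub_eq_zero]
      ext i j
      exact congr_fun (congr_fun h0 i) j
    rw [if_neg h, if_neg h0, mul_zero]

/-! ## Transport indicators are level-`k` functions -/

/-- The pure wave `g ↦ ψ(tr(N g))` of a mode of rank `≤ k` lies in `F_k|_G`. -/
theorem wave_mem {N : Mat p m} (hN : N.rank ≤ k) :
    (fun g : GLm p m => ZMod.stdAddChar (Matrix.trace (N * (g : Mat p m)))) ∈ levelSubmodule p m k := by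
  have hc : RankSupp k (fun M : Mat p m => if M = N then (1 : ℂ) else 0) := by
    intro M hM
    by_cases h : M = N
    · subst h; exact absurd hN (not_le.mpr hM)
    · simp [h]
  have hmem := fourierFn_mem_levelSubmodule hc
  convert hmem using 1
  funext g
  simp [fourierFn, ite_mul]

/-- `rk(B Wᵀ) ≤ k` for `B, W : m × k`. [folklore] -/
theorem rank_mul_transpose_le (B W : Matrix (Fin m) (Fin k) (ZMod p)) : (B * Wᵀ).rank ≤ k :=
  (Matrix.rank_mul_le_left _ _).trans (Matrix.rank_le_width B)

/-- **TRANSPORT INDICATORS ARE LEVEL-`k` FUNCTIONS**: `g ↦ [g B = A] ∈ F_k|_G` for all `m × k` matrices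
`A, B` (a function of the frame image `g B` is a combination of rank-`≤ k` waves). -/
theorem transport_mem (B A : Matrix (Fin m) (Fin k) (ZMod p)) :
    (fun g : GLm p m => if (g : Mat p m) * B = A then (1 : ℂ) else 0) ∈ levelSubmodule p m k := by
  have h : (fun g : GLm p m => if (g : Mat p m) * B = A then (1 : ℂ) else 0) =
      ∑ W : Fin m → Fin k → ZMod p,
        (((p : ℂ) ^ (m * k))⁻¹ * ZMod.stdAddChar (-Matrix.trace (A * (Matrix.of W)ᵀ))) •
          fun g : GLm p m => ZMod.stdAddChar (Matrix.trace (B * (Matrix.of W)ᵀ * (g : Mat p m))) := by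
    funext g
    rw [Finset.sum_apply, transport_eq_sum, Finset.mul_sum]
    refine Finset.sum_congr rfl fun W _ => ?_
    simp only [Pi.smul_apply, smul_eq_mul]
    ring
  rw [h]
  exact Submodule.sum_mem _ fun W _ => Submodule.smul_mem _ _ (wave_mem (rank_mul_transpose_le B _))

/-! ## Frame ghosts annihilate `F_k` (soundness of the FAIL certificate) -/

/-- A rank-factored wave reads the frame image: `ψ(tr(U W g)) = Σ_A [g U = A] ψ(tr(W A))`. -/
theorem wave_eq_sum_transport (U : Matrix (Fin m) (Fin k) (ZMod p)) (W : Matrix (Fin k) (Fin m) (ZMod p))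
    (g : GLm p m) :
    ZMod.stdAddChar (Matrix.trace (U * W * (g : Mat p m))) =
      ∑ A : Matrix (Fin m) (Fin k) (ZMod p),
        (if (g : Mat p m) * U = A then ZMod.stdAddChar (Matrix.trace (W * A)) else 0) := by
  rw [Finset.sum_ite_eq Finset.univ ((g : Mat p m) * U) (fun A => ZMod.stdAddChar (Matrix.trace (W * A))),
    if_pos (Finset.mem_univ _), Matrix.mul_assoc, Matrix.trace_mul_comm, Matrix.mul_assoc]

/-- **FRAME GHOSTS ANNIHILATE EVERY LEVEL-`k` FUNCTION.**  If all transport sums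
`Σ_{g : g B = A} w(g)` (`A, B ∈ M_{m×k}(𝔽_p)`) of a weight `w` on `GL_m(𝔽_p)` vanish, then
`Σ_g w(g) f(g) = 0` for every `f ∈ F_k|_G`. -/
theorem sum_mul_eq_zero_of_frameGhost {w : GLm p m → ℂ}
    (hw : ∀ B A : Matrix (Fin m) (Fin k) (ZMod p),
      (∑ g : GLm p m, (if (g : Mat p m) * B = A then w g else 0)) = 0)
    {f : GLm p m → ℂ} (hf : f ∈ levelSubmodule p m k) : ∑ g : GLm p m, w g * f g = 0 := by
  obtain ⟨c, hc, hfc⟩ := mem_levelSubmodule_iff.mp hf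
  simp_rw [hfc, fourierFn, Finset.mul_sum]
  rw [Finset.sum_comm]
  refine Finset.sum_eq_zero fun M _ => ?_
  by_cases hM : k < M.rank
  · simp [hc M hM]
  obtain ⟨U, W, rfl⟩ := exists_eq_mul_of_rank_le M (not_lt.mp hM)
  have hwave : ∀ g : GLm p m, w g * (c (U * W) * ZMod.stdAddChar (Matrix.trace (U * W * (g : Mat p m)))) =
      ∑ A : Matrix (Fin m) (Fin k) (ZMod p),
        (if (g : Mat p m) * U = A then w g else 0) * (c (U * W) * ZMod.stdAddChar (Matrix.trace (W * A))) := by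
    intro g
    simp_rw [ite_mul, zero_mul]
    rw [Finset.sum_ite_eq, if_pos (Finset.mem_univ _), Matrix.mul_assoc U W (g : Mat p m),
      Matrix.trace_mul_comm U, Matrix.mul_assoc W (g : Mat p m) U]
  simp_rw [hwave]
  rw [Finset.sum_comm]
  refine Finset.sum_eq_zero fun A _ => ?_
  rw [← Finset.sum_mul, hw U A, zero_mul]

/-- **NO LEVEL-`k` IDENTITY TEST IN THE PRESENCE OF A FRAME GHOST.**  A frame ghost `w` supported in
`S ⊆ GL_m(𝔽_p)` with `w(1) ≠ 0` excludes every `f ∈ F_k|_G` with `f(1) = 1` and `f = 0` on `S ∖ {1}`. -/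
theorem no_idTest_of_frameGhost (S : Set (GLm p m)) (w : GLm p m → ℂ)
    (hsupp : ∀ g, w g ≠ 0 → g ∈ S)
    (hw : ∀ B A : Matrix (Fin m) (Fin k) (ZMod p),
      (∑ g : GLm p m, (if (g : Mat p m) * B = A then w g else 0)) = 0)
    (h1 : w 1 ≠ 0) :
    ¬ ∃ f ∈ levelSubmodule p m k, f 1 = 1 ∧ ∀ g ∈ S, g ≠ 1 → f g = 0 := by
  rintro ⟨f, hf, hf1, hf0⟩
  have hval : ∀ g : GLm p m, w g * f g = if g = 1 then w 1 else 0 := by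
    intro g
    split_ifs with h
    · rw [h, hf1, mul_one]
    · by_cases hwg : w g = 0
      · rw [hwg, zero_mul]
      · rw [hf0 g (hsupp g hwg) h, mul_zero]
  have hsum := sum_mul_eq_zero_of_frameGhost hw hf
  simp_rw [hval] at hsum
  rw [Finset.sum_ite_eq' Finset.univ (1 : GLm p m) (fun _ => w 1), if_pos (Finset.mem_univ _)] at hsum
  exact h1 hsum

/-- **The crux-language form (FAIL certificate, every cell `(m,k,p)`).**  If a frame ghost `w` with
`w(1) ≠ 0` is supported on the triple products `a b g` (`a ∈ H₁`, `b ∈ H₂`, `g ∈ H₃`) of three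
subgroups of `GL_m(𝔽_p)`, then the identity-design clause of `SubgroupIdentityDesigns` fails at level
`k` for `(H₁, H₂, H₃)`. -/
theorem no_design_of_frameGhost {H₁ H₂ H₃ : Subgroup (GLm p m)} (w : GLm p m → ℂ)
    (hsupp : ∀ g, w g ≠ 0 → ∃ a ∈ H₁, ∃ b ∈ H₂, ∃ c ∈ H₃, a * b * c = g)
    (hw : ∀ B A : Matrix (Fin m) (Fin k) (ZMod p),
      (∑ g : GLm p m, (if (g : Mat p m) * B = A then w g else 0)) = 0)
    (h1 : w 1 ≠ 0) :
    ¬ ∃ c : Mat p m → ℂ, (∀ M, k < M.rank → c M = 0) ∧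
      (∑ M, c M * ZMod.stdAddChar (Matrix.trace (M * ((1 : GLm p m) : Mat p m)))) = 1 ∧
      ∀ a ∈ H₁, ∀ b ∈ H₂, ∀ g ∈ H₃, a * b * g ≠ 1 →
        (∑ M, c M * ZMod.stdAddChar (Matrix.trace (M * ((a * b * g : GLm p m) : Mat p m)))) = 0 := by
  rintro ⟨c, hc, hc1, hc0⟩
  refine no_idTest_of_frameGhost (k := k)
    ({g | ∃ a ∈ H₁, ∃ b ∈ H₂, ∃ c ∈ H₃, a * b * c = g} : Set (GLm p m)) w (fun g hg => hsupp g hg) hw h1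
    ⟨fourierFn c, fourierFn_mem_levelSubmodule hc, hc1, ?_⟩
  rintro g ⟨a, ha, b, hb, x, hx, rfl⟩ hne
  exact hc0 a ha b hb x hx hne

/-! ## Completeness: no identity test ⇒ a frame ghost exists (finite-dimensional duality) -/

/-- **COMPLETENESS OF THE GHOST CERTIFICATE.**  If `1 ∈ S ⊆ GL_m(𝔽_p)` carries NO level-`k` identity
test, then a frame ghost supported in `S` with `w(1) ≠ 0` exists.  (Duality: `δ_1 · 1_S ∉ (F_k · 1_S)`
gives a functional vanishing on `F_k · 1_S` and not on `δ_1`; its values on the point masses of `S` are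
the ghost, and the transport sums vanish because transport indicators lie in `F_k`, `transport_mem`.) -/
theorem exists_frameGhost_of_no_idTest (S : Set (GLm p m)) (h1S : (1 : GLm p m) ∈ S)
    (h : ¬ ∃ f ∈ levelSubmodule p m k, f 1 = 1 ∧ ∀ g ∈ S, g ≠ 1 → f g = 0) :
    ∃ w : GLm p m → ℂ, (∀ g, w g ≠ 0 → g ∈ S) ∧
      (∀ B A : Matrix (Fin m) (Fin k) (ZMod p),
        (∑ g : GLm p m, (if (g : Mat p m) * B = A then w g else 0)) = 0) ∧ w 1 ≠ 0 := by
  -- cut-off to `S` as a linear map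
  let E : (GLm p m → ℂ) →ₗ[ℂ] (GLm p m → ℂ) :=
    { toFun := fun f g => if g ∈ S then f g else 0
      map_add' := by intro f f'; funext g; by_cases hg : g ∈ S <;> simp [hg]
      map_smul' := by intro r f; funext g; by_cases hg : g ∈ S <;> simp [hg] }
  have hE : ∀ f g, E f g = if g ∈ S then f g else 0 := fun _ _ => rfl
  set U : Submodule ℂ (GLm p m → ℂ) := (levelSubmodule p m k).map E with hU
  have hδ : (Pi.single (1 : GLm p m) (1 : ℂ) : GLm p m → ℂ) ∉ U := by
    rintro ⟨f, hf, hfδ⟩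
    apply h
    refine ⟨f, hf, ?_, ?_⟩
    · have e := congr_fun hfδ 1
      rw [hE, if_pos h1S] at e
      simpa using e
    · intro g hg hg1
      have e := congr_fun hfδ g
      rw [hE, if_pos hg] at e
      simpa [Pi.single_apply, hg1] using e
  obtain ⟨φ, hφδ, hφU⟩ := Submodule.exists_dual_map_eq_bot_of_notMem hδ inferInstance
  have hφ : ∀ f ∈ levelSubmodule p m k, φ (E f) = 0 := by
    intro f hf
    have hmem : φ (E f) ∈ U.map φ := Submodule.mem_map_of_mem (Submodule.mem_map_of_mem hf)
    rw [hφU] at hmem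
    simpa using hmem
  -- the ghost: values of `φ` on the point masses of `S`
  have key : ∀ f : GLm p m → ℂ,
      (∑ g : GLm p m, (if g ∈ S then φ (Pi.single g 1) else 0) * f g) = φ (E f) := by
    intro f
    conv_rhs => rw [← Finset.univ_sum_single (E f)]
    rw [map_sum]
    refine Finset.sum_congr rfl fun g _ => ?_
    rw [hE]
    by_cases hg : g ∈ S
    · rw [if_pos hg, if_pos hg, mul_comm, ← smul_eq_mul, ← map_smul]
      congr 1
      funext x
      simp [Pi.single_apply]
    · simp [hg]
  refine ⟨fun g => if g ∈ S then φ (Pi.single g 1) else 0, ?_, ?_, ?_⟩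
  · intro g hg
    by_contra hgS
    exact hg (if_neg hgS)
  · intro B A
    have e := key (fun g => if (g : Mat p m) * B = A then (1 : ℂ) else 0)
    rw [hφ _ (transport_mem B A)] at e
    refine Eq.trans (Finset.sum_congr rfl fun g _ => ?_) e
    by_cases hg : (g : Mat p m) * B = A <;> simp [hg]
  · simpa [if_pos h1S] using hφδ

/-- **THE FRAME-GHOST CRITERION (both directions).**  For `1 ∈ S ⊆ GL_m(𝔽_p)`: a level-`k` identity
test on `S` exists iff no frame ghost supported in `S` has `w(1) ≠ 0`. -/
theorem idTest_iff_no_frameGhost (S : Set (GLm p m)) (h1S : (1 : GLm p m) ∈ S) :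
    (∃ f ∈ levelSubmodule p m k, f 1 = 1 ∧ ∀ g ∈ S, g ≠ 1 → f g = 0) ↔
      ¬ ∃ w : GLm p m → ℂ, (∀ g, w g ≠ 0 → g ∈ S) ∧
        (∀ B A : Matrix (Fin m) (Fin k) (ZMod p),
          (∑ g : GLm p m, (if (g : Mat p m) * B = A then w g else 0)) = 0) ∧ w 1 ≠ 0 := by
  constructor
  · rintro hf ⟨w, hsupp, hw, h1⟩
    exact no_idTest_of_frameGhost S w hsupp hw h1 hf
  · intro hno
    by_contra hf
    exact hno (exists_frameGhost_of_no_idTest S h1S hf)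

/-- **THE CRUX'S DESIGN CLAUSE IS DECIDED BY FRAME GHOSTS (every cell `(m,k,p)`, every subgroup
triple).**  The identity-design clause of `SubgroupIdentityDesigns` at level `k` holds for
`(H₁, H₂, H₃)` iff no frame ghost with `w(1) ≠ 0` is supported on the triple products `H₁H₂H₃`. -/
theorem design_iff_no_frameGhost (H₁ H₂ H₃ : Subgroup (GLm p m)) :
    (∃ c : Mat p m → ℂ, (∀ M, k < M.rank → c M = 0) ∧
      (∑ M, c M * ZMod.stdAddChar (Matrix.trace (M * ((1 : GLm p m) : Mat p m)))) = 1 ∧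
      ∀ a ∈ H₁, ∀ b ∈ H₂, ∀ g ∈ H₃, a * b * g ≠ 1 →
        (∑ M, c M * ZMod.stdAddChar (Matrix.trace (M * ((a * b * g : GLm p m) : Mat p m)))) = 0) ↔
    ¬ ∃ w : GLm p m → ℂ, (∀ g, w g ≠ 0 → ∃ a ∈ H₁, ∃ b ∈ H₂, ∃ c ∈ H₃, a * b * c = g) ∧
      (∀ B A : Matrix (Fin m) (Fin k) (ZMod p),
        (∑ g : GLm p m, (if (g : Mat p m) * B = A then w g else 0)) = 0) ∧ w 1 ≠ 0 := by
  have h1S : (1 : GLm p m) ∈ ({g | ∃ a ∈ H₁, ∃ b ∈ H₂, ∃ c ∈ H₃, a * b * c = g} : Set (GLm p m)) :=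
    ⟨1, H₁.one_mem, 1, H₂.one_mem, 1, H₃.one_mem, by rw [mul_one, mul_one]⟩
  have hequiv : (∃ c : Mat p m → ℂ, (∀ M, k < M.rank → c M = 0) ∧
      (∑ M, c M * ZMod.stdAddChar (Matrix.trace (M * ((1 : GLm p m) : Mat p m)))) = 1 ∧
      ∀ a ∈ H₁, ∀ b ∈ H₂, ∀ g ∈ H₃, a * b * g ≠ 1 →
        (∑ M, c M * ZMod.stdAddChar (Matrix.trace (M * ((a * b * g : GLm p m) : Mat p m)))) = 0) ↔
      (∃ f ∈ levelSubmodule p m k, f 1 = 1 ∧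
        ∀ g ∈ ({g | ∃ a ∈ H₁, ∃ b ∈ H₂, ∃ c ∈ H₃, a * b * c = g} : Set (GLm p m)), g ≠ 1 → f g = 0) := by
    constructor
    · rintro ⟨c, hc, hc1, hc0⟩
      refine ⟨fourierFn c, fourierFn_mem_levelSubmodule hc, hc1, ?_⟩
      rintro g ⟨a, ha, b, hb, x, hx, rfl⟩ hne
      exact hc0 a ha b hb x hx hne
    · rintro ⟨f, hf, hf1, hf0⟩
      obtain ⟨c, hc, hfc⟩ := mem_levelSubmodule_iff.mp hf
      refine ⟨c, hc, ?_, ?_⟩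
      · have e := hfc 1
        rw [hf1] at e
        exact e.symm
      · intro a ha b hb g hg hne
        have e := hfc (a * b * g)
        rw [hf0 (a * b * g) ⟨a, ha, b, hb, g, hg, rfl⟩ hne] at e
        exact e.symm
  exact hequiv.trans (idTest_iff_no_frameGhost _ h1S)

end FrameGhost
end Summit.MatrixMultiplication.MatrixMultiplication.Theorems.SubgroupIdentityDesigns.Negative
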